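import Summits.BirchSwinnertonDyer.BirchSwinnertonDyer.Theses.TorsionLayerDescent
import Summits.BirchSwinnertonDyer.BirchSwinnertonDyer.Theses.PrintX9
import HarnessLib

/-!
# Line `torsion-depth-light` on crux stmt-BirchSwinnertonDyer-24424 `HowardContainmentLightFrame` (route PrintX9, rev 13+)
= line `torsion-depth` (crux 23161) RESTRICTED TO LIGHT FRAMES: extra binders `Odd d_K`, `(irr_K)`, `rank E(K) = 1`,
`Ш(E/K)[p^∞]` finite; at corank one CGLS 2022 Cor. 3.4.2 removes `1/(γ-1)`, so the localized stub inverts `p` ONLY and the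
open promotion is the μ-PART alone (`stub_depthPos_muPart`). Original header of the parent line follows.
#
(shared by routes TorsionLayerDescent and PrintX9; registry crux decl =
`Summit.BirchSwinnertonDyer.BirchSwinnertonDyer.Theses.PrintX9.HowardContainmentLightFrame`).

REGIME SPLIT BY THE TORSION DEPTH `δ` of the frame (`p^δ = [K_∞ ∩ H_K : K]`, Howard 2007 §3.3's `δ`,
CGLS 2022's `d(k)`-shift, Fouquet 2013's `L`): the printed Heegner-point Kolyvagin-system arguments
(Howard 2004 Thm. B; Mastella–Zerman 2026 Cor. 4.6 at scalar image) use `p ∤ h_K` ONLY through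
`δ = 0` (linear disjointness `K_∞ ∩ K[1] = K`, `K_k ⊂ K[p^{k+1}]`, total ramification above `p`);
at `δ > 0` CGLS 2022 Thms. 3.4.1 + 4.1 give the divisibility after inverting `p` and `γ - 1`, and
the `(p, γ-1)`-primary promotion is the genuinely open piece. `δ = 0` is typed WITHOUT new
definitions as `¬ (ringClassSubgroup K 1 jbar ≤ κ.layerSubgroup 1)` (`K_1 ⊄ K[1] = H_K`).

Shape (the registered-skeleton convention): each stub STATEMENT is a named proposition `Stmt.stub_<name>`
(head constant, so the harness matches hypotheses by name), each stub is `theorem stub_<name> : Stmt.stub_<name> := by sorry`,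
and the composition takes `(hᵢ : Stmt.stub_<name>)`. Stubs (each over existing declarations; `sorry` only inside `stub_*`):
* `stub_coprimeClassNumber` — the printed regime `p ∤ h_K` (Mastella–Zerman Cor. 4.6 = tree fact
  `MastellaZerman2026.cor46_howardDivisibility_of_scalarImage`, discharged on X9 by
  `X9.heegnerContainment_of_cor46`; print modulo that cite-only fact).
* `stub_depthZero_divisibleClassNumber` — `p ∣ h_K` but `δ = 0`: Howard/MZ26 verbatim with the
  layers `K_k` defined intrinsically (beyond print BY NAME only).
* `stub_depthPos_localized` — `δ > 0`: the containment in `Λ[1/p, 1/T]`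
  (CGLS 2022 Thm. 3.4.1 (ii) + Thm. 4.1, any `h_K`, `E(K)[p] = 0`; tree family ⊆ CGLS envelope).
* `stub_depthPos_muPart` — `δ > 0`: from the localized to the integral containment
  (the `μ`-part and the `T`-part of Howard's divisibility at positive torsion depth).
Composition `HowardContainmentAnyClassNumber_of` is sorry-free (case split on `p ∣ h_K`, then on `δ`).
-/

set_option linter.dupNamespace false
set_option autoImplicit false

namespace Summit.BirchSwinnertonDyer.BirchSwinnertonDyer.Cruxes.HowardContainmentLightFrame.TorsionDepthLight

open Literature.NumberTheory.EllipticCurves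

/-! ## Stub statements as named propositions -/

/-- **Regime `p ∤ h_K` (PRINT modulo the cite-only fact MZ26 Cor. 4.6).** Howard's containment on an
X9 Heegner frame whose class number is prime to `p`, for the GIVEN embedding `jbar`.
[cite: MastellaZerman2026, Cor. 4.6 (arXiv:2505.08710)] [cite: BurungaleCastellaKim2021, Thm. 3.1] -/
def Stmt.stub_coprimeClassNumber : Prop :=
    ∀ (W : WeierstrassCurve ℚ) [W.IsElliptic] [W.IsGloballyMinimal] (p : ℕ) [Fact p.Prime]
      [NeZero (W.conductorNorm ℤ)] (K : Type) [Field K] [NumberField K],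
      Summit.BirchSwinnertonDyer.BirchSwinnertonDyer.Rank1Residual.ClassX9 W p →
      IsImaginaryQuadratic K → Odd (NumberField.discr K) → NumberField.discr K ≠ -3 →
      SatisfiesHeegnerHypothesis (W.conductorNorm ℤ) K → SatisfiesHeegnerHypothesis p K →
      (W.baseChange K).HasIrreducibleModPGaloisRep p →
      ∀ (κ : ZpExtension K p), κ.IsAnticyclotomic → ∀ (γ : Field.absoluteGaloisGroup K),
      κ.IsTopGenerator γ →
      ∀ (Dt : ModularForms.ModularParametrizationData W (W.conductorNorm ℤ))
        (H : HeegnerDatum (W.conductorNorm ℤ) (NumberField.discr K)) (ιC : K →+* ℂ)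
        (jbar : AlgebraicClosure K →+* ℂ),
      (W.baseChange K).mordellWeilRank = 1 →
      Finite (AddCommGroup.primaryComponent (W.baseChange K).sha p) →
      ¬ p ∣ NumberField.classNumber K →
      ∃ (D : (W.baseChange K).LambdaAdicSelmerData κ γ)
        (F : HeegnerFamily (W.conductorNorm ℤ) W K κ jbar) (X : (W.baseChange K).SelmerDualData κ γ),
        heegnerCharIdeal D F ^ 2 ≤
          Module.charIdeal (IwasawaAlgebra p) (Submodule.torsion (IwasawaAlgebra p) X.X)

/-- **Regime `p ∣ h_K`, torsion depth `δ = 0`** (`K_1 ⊄ H_K`, i.e. `K_∞ ∩ H_K = K`): Howard's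
containment — the printed proofs (Howard 2004 §3.3, Mastella–Zerman 2026 §3) use `p ∤ h_K` only through
`δ = 0` once the layers `K_k` are the intrinsic anticyclotomic layers. Beyond print BY NAME.
[cite: Howard2004HeegnerKolyvagin, Thm. B, §3.3, Lemma 2.3.4] [cite: MastellaZerman2026, §3, Cor. 4.6]
[cite: Howard2007, §3.3 (δ)] -/
def Stmt.stub_depthZero_divisibleClassNumber : Prop :=
    ∀ (W : WeierstrassCurve ℚ) [W.IsElliptic] [W.IsGloballyMinimal] (p : ℕ) [Fact p.Prime]
      [NeZero (W.conductorNorm ℤ)] (K : Type) [Field K] [NumberField K],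
      Summit.BirchSwinnertonDyer.BirchSwinnertonDyer.Rank1Residual.ClassX9 W p →
      IsImaginaryQuadratic K → Odd (NumberField.discr K) → NumberField.discr K ≠ -3 →
      SatisfiesHeegnerHypothesis (W.conductorNorm ℤ) K → SatisfiesHeegnerHypothesis p K →
      (W.baseChange K).HasIrreducibleModPGaloisRep p →
      ∀ (κ : ZpExtension K p), κ.IsAnticyclotomic → ∀ (γ : Field.absoluteGaloisGroup K),
      κ.IsTopGenerator γ →
      ∀ (Dt : ModularForms.ModularParametrizationData W (W.conductorNorm ℤ))
        (H : HeegnerDatum (W.conductorNorm ℤ) (NumberField.discr K)) (ιC : K →+* ℂ)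
        (jbar : AlgebraicClosure K →+* ℂ),
      (W.baseChange K).mordellWeilRank = 1 →
      Finite (AddCommGroup.primaryComponent (W.baseChange K).sha p) →
      p ∣ NumberField.classNumber K →
      ¬ (ringClassSubgroup K 1 jbar ≤ κ.layerSubgroup 1) →
      ∃ (D : (W.baseChange K).LambdaAdicSelmerData κ γ)
        (F : HeegnerFamily (W.conductorNorm ℤ) W K κ jbar) (X : (W.baseChange K).SelmerDualData κ γ),
        heegnerCharIdeal D F ^ 2 ≤
          Module.charIdeal (IwasawaAlgebra p) (Submodule.torsion (IwasawaAlgebra p) X.X)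

/-- **Torsion depth `δ > 0` (`K_1 ⊆ H_K`), LOCALIZED form**: the containment after inverting `p` and
`T = γ - 1`, i.e. `(p^m T^n) · I(ℋ_∞)² ⊆ char_Λ(X_tors)` for some `m n` — CGLS 2022 Thm. 3.4.1 (ii)
for the Heegner Kolyvagin system of Thm. 4.1 (`d(k)`-shifted norms; any `h_K`, `E(K)[p] = 0`), plus
the envelope bookkeeping "tree Heegner module ⊆ `Λ κ₁^{Hg}`" (distribution relations).
[cite: CastellaGrossiLeeSkinner2022, Thm. 3.4.1 (ii), Thm. 4.1, Remark 4.2 (arXiv:2008.02571 §3.4, §4)] -/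
def Stmt.stub_depthPos_localized : Prop :=
    ∀ (W : WeierstrassCurve ℚ) [W.IsElliptic] [W.IsGloballyMinimal] (p : ℕ) [Fact p.Prime]
      [NeZero (W.conductorNorm ℤ)] (K : Type) [Field K] [NumberField K],
      Summit.BirchSwinnertonDyer.BirchSwinnertonDyer.Rank1Residual.ClassX9 W p →
      IsImaginaryQuadratic K → Odd (NumberField.discr K) → NumberField.discr K ≠ -3 →
      SatisfiesHeegnerHypothesis (W.conductorNorm ℤ) K → SatisfiesHeegnerHypothesis p K →
      (W.baseChange K).HasIrreducibleModPGaloisRep p →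
      ∀ (κ : ZpExtension K p), κ.IsAnticyclotomic → ∀ (γ : Field.absoluteGaloisGroup K),
      κ.IsTopGenerator γ →
      ∀ (Dt : ModularForms.ModularParametrizationData W (W.conductorNorm ℤ))
        (H : HeegnerDatum (W.conductorNorm ℤ) (NumberField.discr K)) (ιC : K →+* ℂ)
        (jbar : AlgebraicClosure K →+* ℂ),
      (W.baseChange K).mordellWeilRank = 1 →
      Finite (AddCommGroup.primaryComponent (W.baseChange K).sha p) →
      ringClassSubgroup K 1 jbar ≤ κ.layerSubgroup 1 →
      ∃ (D : (W.baseChange K).LambdaAdicSelmerData κ γ)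
        (F : HeegnerFamily (W.conductorNorm ℤ) W K κ jbar) (X : (W.baseChange K).SelmerDualData κ γ)
        (m : ℕ),
        Ideal.span {((p : IwasawaAlgebra p) ^ m)} * heegnerCharIdeal D F ^ 2 ≤
          Module.charIdeal (IwasawaAlgebra p) (Submodule.torsion (IwasawaAlgebra p) X.X)

/-- **Torsion depth `δ > 0`, PROMOTION**: from the localized containment (some `p^m T^n`) to the
integral one — the `μ`-part (`p`) and the augmentation part (`T`) of Howard's divisibility at positive
torsion depth (print: `T`-part at corank one by CGLS Cor. 3.4.2; `μ`-part 'essentially' Fouquet 2013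
Thm. B (ii) under Ass. 5.10; at `p ∤ h_K` Mastella–Zerman). The genuinely open piece of the crux.
[cite: CastellaGrossiLeeSkinner2022, Cor. 3.4.2] [cite: Fouquet2013, Thm. B (ii)] -/
def Stmt.stub_depthPos_muPart : Prop :=
    ∀ (W : WeierstrassCurve ℚ) [W.IsElliptic] [W.IsGloballyMinimal] (p : ℕ) [Fact p.Prime]
      [NeZero (W.conductorNorm ℤ)] (K : Type) [Field K] [NumberField K],
      Summit.BirchSwinnertonDyer.BirchSwinnertonDyer.Rank1Residual.ClassX9 W p →
      IsImaginaryQuadratic K → Odd (NumberField.discr K) → NumberField.discr K ≠ -3 →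
      SatisfiesHeegnerHypothesis (W.conductorNorm ℤ) K → SatisfiesHeegnerHypothesis p K →
      (W.baseChange K).HasIrreducibleModPGaloisRep p →
      ∀ (κ : ZpExtension K p), κ.IsAnticyclotomic → ∀ (γ : Field.absoluteGaloisGroup K),
      κ.IsTopGenerator γ →
      ∀ (Dt : ModularForms.ModularParametrizationData W (W.conductorNorm ℤ))
        (H : HeegnerDatum (W.conductorNorm ℤ) (NumberField.discr K)) (ιC : K →+* ℂ)
        (jbar : AlgebraicClosure K →+* ℂ),
      (W.baseChange K).mordellWeilRank = 1 →
      Finite (AddCommGroup.primaryComponent (W.baseChange K).sha p) →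
      ringClassSubgroup K 1 jbar ≤ κ.layerSubgroup 1 →
      (∃ (D : (W.baseChange K).LambdaAdicSelmerData κ γ)
        (F : HeegnerFamily (W.conductorNorm ℤ) W K κ jbar) (X : (W.baseChange K).SelmerDualData κ γ)
        (m : ℕ),
        Ideal.span {((p : IwasawaAlgebra p) ^ m)} * heegnerCharIdeal D F ^ 2 ≤
          Module.charIdeal (IwasawaAlgebra p) (Submodule.torsion (IwasawaAlgebra p) X.X)) →
      ∃ (D : (W.baseChange K).LambdaAdicSelmerData κ γ)
        (F : HeegnerFamily (W.conductorNorm ℤ) W K κ jbar) (X : (W.baseChange K).SelmerDualData κ γ),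
        heegnerCharIdeal D F ^ 2 ≤
          Module.charIdeal (IwasawaAlgebra p) (Submodule.torsion (IwasawaAlgebra p) X.X)

/-! ## The stubs (the ONLY sorries of the file) -/

theorem stub_coprimeClassNumber : Stmt.stub_coprimeClassNumber := by
  sorry

theorem stub_depthZero_divisibleClassNumber : Stmt.stub_depthZero_divisibleClassNumber := by
  sorry

theorem stub_depthPos_localized : Stmt.stub_depthPos_localized := by
  sorry

theorem stub_depthPos_muPart : Stmt.stub_depthPos_muPart := by
  sorry

/-! ## Composition (kernel-checked, no `sorry`) -/

/-- **The four regime stubs give the crux BY NAME.** Fix the frame, realise `jbar := IsAlgClosed.lift` along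
`ιC` (as in `X9.heegnerContainment_of_cor46`), split on `p ∣ h_K` and then on the torsion depth at `jbar`. -/
theorem HowardContainmentLightFrame_of
    (h₁ : Stmt.stub_coprimeClassNumber) (h₂ : Stmt.stub_depthZero_divisibleClassNumber)
    (h₃ : Stmt.stub_depthPos_localized) (h₄ : Stmt.stub_depthPos_muPart) :
    Summit.BirchSwinnertonDyer.BirchSwinnertonDyer.Theses.PrintX9.HowardContainmentLightFrame := by
  unfold Stmt.stub_coprimeClassNumber at h₁
  unfold Stmt.stub_depthZero_divisibleClassNumber at h₂
  unfold Stmt.stub_depthPos_localized at h₃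
  unfold Stmt.stub_depthPos_muPart at h₄
  intro W _ _ p _ _ K _ _ hX9 hK hodd h3 hHN hHp hirr κ hκ γ hγ Dt H ιC hrk hfin
  letI : Algebra K ℂ := ιC.toAlgebra
  let jbar : AlgebraicClosure K →+* ℂ :=
    (IsAlgClosed.lift (R := K) (M := ℂ) (S := AlgebraicClosure K)).toRingHom
  by_cases hh : p ∣ NumberField.classNumber K
  · by_cases hδ : ringClassSubgroup K 1 jbar ≤ κ.layerSubgroup 1
    · obtain ⟨D, F, X, hc⟩ := h₄ W p K hX9 hK hodd h3 hHN hHp hirr κ hκ γ hγ Dt H ιC jbar hrk hfin hδ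
        (h₃ W p K hX9 hK hodd h3 hHN hHp hirr κ hκ γ hγ Dt H ιC jbar hrk hfin hδ)
      exact ⟨jbar, D, F, X, hc⟩
    · obtain ⟨D, F, X, hc⟩ := h₂ W p K hX9 hK hodd h3 hHN hHp hirr κ hκ γ hγ Dt H ιC jbar hrk hfin hh hδ
      exact ⟨jbar, D, F, X, hc⟩
  · obtain ⟨D, F, X, hc⟩ := h₁ W p K hX9 hK hodd h3 hHN hHp hirr κ hκ γ hγ Dt H ιC jbar hrk hfin hh
    exact ⟨jbar, D, F, X, hc⟩

/-- The composed line from the four stubs (sorries only through `stub_*`). -/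
theorem HowardContainmentLightFrame_of_stubs :
    Summit.BirchSwinnertonDyer.BirchSwinnertonDyer.Theses.PrintX9.HowardContainmentLightFrame :=
  HowardContainmentLightFrame_of stub_coprimeClassNumber stub_depthZero_divisibleClassNumber
    stub_depthPos_localized stub_depthPos_muPart

end Summit.BirchSwinnertonDyer.BirchSwinnertonDyer.Cruxes.HowardContainmentLightFrame.TorsionDepthLight
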